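import Mathlib.GroupTheory.SpecificGroups.Quaternion
import Mathlib.Tactic.LinearCombination
import Literature.Combinatorics.Additive.TripleProductProperty
import Summits.MatrixMultiplication.OmegaCensus.DihedralLikeLaw
import HarnessLib

/-!
# The dicyclic TPP family `({1,x}, {1,xa}, ⟨a³⟩ ∪ x a² ⟨a³⟩)` in `Q_{12m}`: `β(Q_{4n}) = 4⌊4n/3⌋` for `3 ∣ n`

ω-census, family (b3).  Framing: lottery ticket; floor = certified bounds/negative ranges.

In `Q_{4n} = QuaternionGroup n` with `n = 3m` the sets `S = {1, x}`, `T = {1, x a}`,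
`U = {a^{3j}} ∪ {x a^{2+3j}}` (`|U| = 4m`) have the triple product property (`dicyclic_family_tpp`; the 64
membership cases reduce to linear equations in `ZMod 6m`, the illegitimate ones say `3y ∈ {±1, ±2}`), so
`β(Q_{12m}) ≥ 16m = 4⌊|Q_{12m}|/3⌋`; with the kernel upper bound `tpp_volume_le_law_quaternion`
(`DihedralLikeLaw.lean`) this is the exact dicyclic law `β(Q_{4n}) = 4⌊4n/3⌋` for `3 ∣ n` (`dicyclic_law_of_three_dvd`).
(Seat data: the bound is also attained for `n ≡ 2 (mod 3)`, `n ≤ 11`, by ad-hoc triples, and missed by the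
`(2,2,c)` patterns for `n ≡ 1 (mod 3)`.)
-/

namespace Summit.MatrixMultiplication.OmegaCensus

open Literature.Combinatorics.Additive Finset

/-- Inverses in `QuaternionGroup n` (definitional). [folklore] -/
theorem quaternion_inv_a {n : ℕ} (i : ZMod (2 * n)) : (QuaternionGroup.a i)⁻¹ = QuaternionGroup.a (-i) := rfl

/-- Inverses in `QuaternionGroup n` (definitional). [folklore] -/
theorem quaternion_inv_xa {n : ℕ} (i : ZMod (2 * n)) :
    (QuaternionGroup.xa i)⁻¹ = QuaternionGroup.xa ((n : ZMod (2 * n)) + i) := rfl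

/-- In `ZMod (2·3m)` a multiple of `3` is never `±1, ±2`. [folklore] -/
theorem three_mul_ne_small' (m : ℕ) [NeZero m] (x : ZMod (2 * (3 * m))) :
    3 * x ≠ 1 ∧ 3 * x ≠ 2 ∧ 3 * x ≠ -1 ∧ 3 * x ≠ -2 := by
  have h3 : (3 : ℕ) ∣ 2 * (3 * m) := Dvd.dvd.mul_left (dvd_mul_right 3 m) 2
  let φ := ZMod.castHom h3 (ZMod 3)
  have hφ3 : φ (3 * x) = 0 := by
    rw [map_mul]
    have : φ 3 = 0 := by rw [map_ofNat]; decide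
    rw [this, zero_mul]
  refine ⟨fun h => ?_, fun h => ?_, fun h => ?_, fun h => ?_⟩ <;>
  · have := congrArg φ h
    rw [hφ3] at this
    revert this
    simp only [map_one, map_neg, map_ofNat]
    decide

/-- `2n = 0` in `ZMod (2n)`, in the form `n + n = 0` for `n = 3m`. [folklore] -/
theorem natCast_add_self_eq_zero (m : ℕ) :
    ((3 * m : ℕ) : ZMod (2 * (3 * m))) + ((3 * m : ℕ) : ZMod (2 * (3 * m))) = 0 := by
  have : ((2 * (3 * m) : ℕ) : ZMod (2 * (3 * m))) = 0 := ZMod.natCast_self _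
  push_cast at this ⊢
  linear_combination this

/-- Reduction modulo `3`: the cast `ZMod (2·3m) → ZMod 3` kills `3x` and `3m`. [folklore] -/
theorem castHom_three_mul_eq_zero (m : ℕ) (x : ZMod (2 * (3 * m))) :
    ZMod.castHom (Dvd.dvd.mul_left (dvd_mul_right 3 m) 2) (ZMod 3) (3 * x) = 0 := by
  rw [map_mul, map_ofNat]
  have : (3 : ZMod 3) = 0 := by decide
  rw [this, zero_mul]

/-- Reduction modulo `3` of the cast of `3m`. [folklore] -/
theorem castHom_natCast_three_mul_eq_zero (m : ℕ) :
    ZMod.castHom (Dvd.dvd.mul_left (dvd_mul_right 3 m) 2) (ZMod 3) ((3 * m : ℕ) : ZMod (2 * (3 * m))) = 0 := by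
  rw [map_natCast, Nat.cast_mul]
  have : ((3 : ℕ) : ZMod 3) = 0 := by decide
  rw [this, zero_mul]

/-- **The dicyclic TPP family**: for every `m ≥ 1`, in `Q_{12m} = QuaternionGroup (3m)` the triple `S = {1, x}`,
`T = {1, x a}`, `U = {a^{3j}} ∪ {x a^{2+3j}}` has the triple product property (64 membership cases: the legitimate
ones are linear identities in `ZMod 6m` using `2·3m = 0`, the others are refuted modulo `3`). [folklore] -/
theorem dicyclic_family_tpp (m : ℕ) [NeZero m] :
    TripleProductProperty ({QuaternionGroup.a 0, QuaternionGroup.xa 0} : Finset (QuaternionGroup (3 * m)))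
      ({QuaternionGroup.a 0, QuaternionGroup.xa 1} : Finset (QuaternionGroup (3 * m)))
      ((univ.image fun j : ZMod (2 * (3 * m)) => QuaternionGroup.a (3 * j)) ∪
        (univ.image fun j : ZMod (2 * (3 * m)) => QuaternionGroup.xa (2 + 3 * j))) := by
  have hnn := natCast_add_self_eq_zero m
  have k3 := castHom_three_mul_eq_zero m
  have k3m := castHom_natCast_three_mul_eq_zero m
  intro s hs s' hs' t ht t' ht' u hu u' hu' heq
  simp only [mem_insert, mem_singleton, mem_union, mem_image, mem_univ, true_and] at hs hs' ht ht' hu hu'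
  rcases hu with ⟨j, rfl⟩ | ⟨j, rfl⟩ <;> rcases hu' with ⟨j', rfl⟩ | ⟨j', rfl⟩ <;>
  rcases hs with rfl | rfl <;> rcases hs' with rfl | rfl <;> rcases ht with rfl | rfl <;> rcases ht' with rfl | rfl <;>
  simp only [QuaternionGroup.a_mul_a, QuaternionGroup.a_mul_xa, QuaternionGroup.xa_mul_a, QuaternionGroup.xa_mul_xa,
    quaternion_inv_a, quaternion_inv_xa, QuaternionGroup.one_def, QuaternionGroup.a.injEq, QuaternionGroup.xa.injEq,
    reduceCtorEq, true_and, and_self, neg_zero, add_zero, zero_add, sub_zero] at heq ⊢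
  all_goals first
    | linear_combination heq
    | linear_combination -heq
    | linear_combination heq + hnn
    | linear_combination heq - hnn
    | linear_combination -heq + hnn
    | linear_combination -heq - hnn
    | linear_combination heq + 2 * hnn
    | linear_combination heq - 2 * hnn
    | linear_combination -heq + 2 * hnn
    | linear_combination -heq - 2 * hnn
    | linear_combination heq + 3 * hnn
    | linear_combination heq - 3 * hnn
    | linear_combination -heq + 3 * hnn
    | linear_combination -heq - 3 * hnn
    | linear_combination heq + 4 * hnn
    | linear_combination heq - 4 * hnn
    | (exfalso
       have h3 := congrArg (ZMod.castHom (Dvd.dvd.mul_left (dvd_mul_right 3 m) 2) (ZMod 3)) heq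
       simp only [map_add, map_sub, map_neg, k3, k3m, map_one, map_zero, map_ofNat] at h3
       revert h3
       decide)

/-- The rotation part of the family has at least `2m` elements (`a(3i)`, `i < 2m`, are distinct). [folklore] -/
theorem card_image_a_three_mul (m : ℕ) [NeZero m] :
    2 * m ≤ ((univ : Finset (ZMod (2 * (3 * m)))).image fun j => QuaternionGroup.a (3 * j)).card := by
  have hinj : Function.Injective fun i : Fin (2 * m) =>
      (QuaternionGroup.a (3 * ((i : ℕ) : ZMod (2 * (3 * m)))) : QuaternionGroup (3 * m)) := by
    intro i i' h
    simp only [QuaternionGroup.a.injEq] at h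
    have h3 : ((3 * (i : ℕ) : ℕ) : ZMod (2 * (3 * m))) = ((3 * (i' : ℕ) : ℕ) : ZMod (2 * (3 * m))) := by
      push_cast; exact h
    rw [ZMod.natCast_eq_natCast_iff'] at h3
    have hi := i.isLt; have hi' := i'.isLt
    rw [Nat.mod_eq_of_lt (by omega), Nat.mod_eq_of_lt (by omega)] at h3
    exact Fin.ext (by omega)
  calc 2 * m = (univ : Finset (Fin (2 * m))).card := by simp
    _ = ((univ : Finset (Fin (2 * m))).image fun i : Fin (2 * m) =>
          (QuaternionGroup.a (3 * ((i : ℕ) : ZMod (2 * (3 * m)))) : QuaternionGroup (3 * m))).card :=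
        (card_image_of_injective _ hinj).symm
    _ ≤ _ := by
        apply card_le_card
        intro x hx
        simp only [mem_image, mem_univ, true_and] at hx ⊢
        obtain ⟨i, rfl⟩ := hx
        exact ⟨((i : ℕ) : ZMod (2 * (3 * m))), rfl⟩

/-- The reflection part of the family has at least `2m` elements. [folklore] -/
theorem card_image_xa_three_mul (m : ℕ) [NeZero m] :
    2 * m ≤ ((univ : Finset (ZMod (2 * (3 * m)))).image fun j => QuaternionGroup.xa (2 + 3 * j)).card := by
  have hinj : Function.Injective fun i : Fin (2 * m) =>
      (QuaternionGroup.xa (2 + 3 * ((i : ℕ) : ZMod (2 * (3 * m)))) : QuaternionGroup (3 * m)) := by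
    intro i i' h
    simp only [QuaternionGroup.xa.injEq, add_right_inj] at h
    have h3 : ((3 * (i : ℕ) : ℕ) : ZMod (2 * (3 * m))) = ((3 * (i' : ℕ) : ℕ) : ZMod (2 * (3 * m))) := by
      push_cast; exact h
    rw [ZMod.natCast_eq_natCast_iff'] at h3
    have hi := i.isLt; have hi' := i'.isLt
    rw [Nat.mod_eq_of_lt (by omega), Nat.mod_eq_of_lt (by omega)] at h3
    exact Fin.ext (by omega)
  calc 2 * m = (univ : Finset (Fin (2 * m))).card := by simp
    _ = ((univ : Finset (Fin (2 * m))).image fun i : Fin (2 * m) =>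
          (QuaternionGroup.xa (2 + 3 * ((i : ℕ) : ZMod (2 * (3 * m)))) : QuaternionGroup (3 * m))).card :=
        (card_image_of_injective _ hinj).symm
    _ ≤ _ := by
        apply card_le_card
        intro x hx
        simp only [mem_image, mem_univ, true_and] at hx ⊢
        obtain ⟨i, rfl⟩ := hx
        exact ⟨((i : ℕ) : ZMod (2 * (3 * m))), rfl⟩

/-- **The dicyclic law for `3 ∣ n`: `β(Q_{12m}) = 16m = 4⌊|Q_{12m}|/3⌋`**, both halves kernel: every TPP triple of
`QuaternionGroup (3m)` has volume `≤ 16m` (`tpp_volume_le_law_quaternion`) and the family above attains it.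
[folklore] -/
theorem dicyclic_law_of_three_dvd (m : ℕ) [NeZero m] :
    (∀ S T U : Finset (QuaternionGroup (3 * m)), TripleProductProperty S T U → S.card * T.card * U.card ≤ 16 * m) ∧
    ∃ S T U : Finset (QuaternionGroup (3 * m)), TripleProductProperty S T U ∧ S.card * T.card * U.card = 16 * m := by
  refine ⟨fun S T U h => ?_, ?_⟩
  · have := tpp_volume_le_law_quaternion h
    omega
  · have htpp := dicyclic_family_tpp m
    refine ⟨_, _, _, htpp, ?_⟩
    have hup := tpp_volume_le_law_quaternion htpp
    have hS : ({QuaternionGroup.a 0, QuaternionGroup.xa 0} : Finset (QuaternionGroup (3 * m))).card = 2 := by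
      rw [card_insert_of_notMem (by rw [mem_singleton]; intro h; cases h), card_singleton]
    have hT : ({QuaternionGroup.a 0, QuaternionGroup.xa 1} : Finset (QuaternionGroup (3 * m))).card = 2 := by
      rw [card_insert_of_notMem (by rw [mem_singleton]; intro h; cases h), card_singleton]
    have hdisj : Disjoint ((univ : Finset (ZMod (2 * (3 * m)))).image fun j => QuaternionGroup.a (3 * j))
        ((univ : Finset (ZMod (2 * (3 * m)))).image fun j => QuaternionGroup.xa (2 + 3 * j)) := by
      rw [disjoint_left]
      intro x hx hx'
      simp only [mem_image, mem_univ, true_and] at hx hx'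
      obtain ⟨j, rfl⟩ := hx
      obtain ⟨j', h⟩ := hx'
      cases h
    have hU := card_union_of_disjoint hdisj
    have h1 := card_image_a_three_mul m
    have h2 := card_image_xa_three_mul m
    rw [hS, hT, hU] at hup ⊢
    omega

end Summit.MatrixMultiplication.OmegaCensus
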